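import Literature.Topology.FourManifolds.PlanarArch
import HarnessLib

/-!
# Smooth clamps: a squash onto the height window and a smooth minimum with a constant

Topic `Literature/Topology/FourManifolds`; fact seat `provefact-IsStrictHandleSlide.isSurgery`
(R. C. Kirby, *The Topology of 4-Manifolds*, LNM 1374 (1989), Ch. I §4; remaining content: the
named fact (S) `Literature.Topology.FourManifolds.FramedLink.IsStrictHandleSlide.slideModel`).
Two elementary `C^∞` devices used to keep the tracks of the finger move inside the height window
of the flat sheet (`FlatSheet.lean`, `HeightGraphSheetFamily.lean`):

* `heightSquash y = 0.12 + (y - 0.12) S₁(y) (1 - S₂(y)) + 0.76 S₂(y)` (`S₁ = smoothStep 0.12 0.15`,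
  `S₂ = smoothStep 0.85 0.88`): `C^∞`, the identity on `[0.15, 0.85]`, values in `[0.12, 0.88]`;
* `smoothMinConst c ε x = x + (c - x) · smoothStep (c - ε) c x`: `C^∞`, `= x` for `x ≤ c - ε`,
  `= c` for `x ≥ c`, between `x` and `c` otherwise, and non-decreasing in `x` below `c`
  (derivative `(1 - S) + (c - x) S' ≥ 0` for `x ≤ c`).

* `heightSquash` (definition), `smoothMinConst` (definition) and their API.

## References

* R. C. Kirby, *The Topology of 4-Manifolds*, LNM 1374, Springer (1989), Ch. I §4. [Kirby1989]
-/

open scoped ContDiff Topology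
open Set Real

noncomputable section

namespace Literature.Topology.FourManifolds

/-! ### The squash onto the height window -/

/-- **The height squash**: `0.12 + (y - 0.12) S₁ y (1 - S₂ y) + 0.76 S₂ y`. [folklore] -/
def heightSquash (y : ℝ) : ℝ :=
  0.12 + (y - 0.12) * smoothStep 0.12 0.15 y * (1 - smoothStep 0.85 0.88 y) + 0.76 * smoothStep 0.85 0.88 y

/-- Unfolding lemma. [folklore] -/
theorem heightSquash_def (y : ℝ) : heightSquash y =
    0.12 + (y - 0.12) * smoothStep 0.12 0.15 y * (1 - smoothStep 0.85 0.88 y) + 0.76 * smoothStep 0.85 0.88 y := rfl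

/-- The squash is `C^∞`. [folklore] -/
theorem contDiff_heightSquash : ContDiff ℝ ∞ heightSquash := by
  unfold heightSquash
  have h1 := contDiff_smoothStep (0.12 : ℝ) 0.15
  have h2 := contDiff_smoothStep (0.85 : ℝ) 0.88
  exact (contDiff_const.add (((contDiff_id.sub contDiff_const).mul h1).mul (contDiff_const.sub h2))).add
    (contDiff_const.mul h2)

/-- **On `[0.15, 0.85]` the squash is the identity.** [folklore] -/
theorem heightSquash_of_mem {y : ℝ} (hy : y ∈ Icc (0.15 : ℝ) 0.85) : heightSquash y = y := by
  rw [heightSquash, smoothStep_of_ge (by norm_num) hy.1, smoothStep_of_le (by norm_num) hy.2]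
  ring

/-- **The squash takes values in `[0.12, 0.88]`.** [folklore] -/
theorem heightSquash_mem (y : ℝ) : heightSquash y ∈ Icc (0.12 : ℝ) 0.88 := by
  have h1 := smoothStep_mem_Icc (0.12 : ℝ) 0.15 y
  have h2 := smoothStep_mem_Icc (0.85 : ℝ) 0.88 y
  rw [heightSquash]
  rcases le_or_gt y 0.12 with hy | hy
  · rw [smoothStep_of_le (by norm_num) hy, smoothStep_of_le (by norm_num) (by linarith)]
    norm_num
  rcases le_or_gt y 0.88 with hy' | hy'
  · -- `0.12 < y ≤ 0.88`: a convex combination of `0.12 + (y - 0.12) S₁ ∈ [0.12, y]` and `0.88`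
    have hA : 0 ≤ (y - 0.12) * smoothStep 0.12 0.15 y := mul_nonneg (by linarith) h1.1
    have hB : (y - 0.12) * smoothStep 0.12 0.15 y ≤ y - 0.12 := mul_le_of_le_one_right (by linarith) h1.2
    constructor <;> nlinarith [h2.1, h2.2]
  · rw [smoothStep_of_ge (by norm_num) (by linarith : (0.15 : ℝ) ≤ y), smoothStep_of_ge (by norm_num) hy'.le]
    norm_num

/-- The squash takes values in the open height window `(1/10, 9/10)`. [folklore] -/
theorem heightSquash_mem_Ioo (y : ℝ) : heightSquash y ∈ Ioo (10⁻¹ : ℝ) (9 / 10) := by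
  have h := heightSquash_mem y
  constructor
  · have : (10⁻¹ : ℝ) < 0.12 := by norm_num
    linarith [h.1]
  · have : (0.88 : ℝ) < 9 / 10 := by norm_num
    linarith [h.2]

/-! ### The smooth minimum with a constant -/

/-- **Smooth minimum with the constant `c`** (transition width `ε`):
`x + (c - x) · smoothStep (c - ε) c x`. [folklore] -/
def smoothMinConst (c ε x : ℝ) : ℝ := x + (c - x) * smoothStep (c - ε) c x

/-- Unfolding lemma. [folklore] -/
theorem smoothMinConst_def (c ε x : ℝ) : smoothMinConst c ε x = x + (c - x) * smoothStep (c - ε) c x := rfl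

/-- The smooth minimum is `C^∞` in `x`. [folklore] -/
theorem contDiff_smoothMinConst (c ε : ℝ) : ContDiff ℝ ∞ (smoothMinConst c ε) := by
  unfold smoothMinConst
  exact contDiff_id.add ((contDiff_const.sub contDiff_id).mul (contDiff_smoothStep _ _))

/-- Below `c - ε` the smooth minimum is `x`. [folklore] -/
theorem smoothMinConst_of_le {c ε x : ℝ} (hε : 0 < ε) (hx : x ≤ c - ε) : smoothMinConst c ε x = x := by
  rw [smoothMinConst, smoothStep_of_le (by linarith) hx]; ring

/-- Above `c` the smooth minimum is `c`. [folklore] -/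
theorem smoothMinConst_of_ge {c ε x : ℝ} (hε : 0 < ε) (hx : c ≤ x) : smoothMinConst c ε x = c := by
  rw [smoothMinConst, smoothStep_of_ge (by linarith) hx]; ring

/-- The smooth minimum lies between `min x c` and `max x c`. [folklore] -/
theorem smoothMinConst_mem (c ε x : ℝ) : smoothMinConst c ε x ∈ Icc (min x c) (max x c) := by
  have h := smoothStep_mem_Icc (c - ε) c x
  rw [smoothMinConst]
  rcases le_total x c with hxc | hxc
  · rw [min_eq_left hxc, max_eq_right hxc]
    constructor <;> nlinarith [h.1, h.2]
  · rw [min_eq_right hxc, max_eq_left hxc]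
    constructor <;> nlinarith [h.1, h.2]

/-- For `x ≤ c` the smooth minimum is at most `c` and at least `x`. [folklore] -/
theorem smoothMinConst_le {c ε x : ℝ} (hx : x ≤ c) : smoothMinConst c ε x ≤ c := by
  have := (smoothMinConst_mem c ε x).2; rwa [max_eq_right hx] at this

/-- The derivative of the smooth minimum. [folklore] -/
theorem hasDerivAt_smoothMinConst (c ε x : ℝ) :
    HasDerivAt (smoothMinConst c ε) ((1 - smoothStep (c - ε) c x) + (c - x) * deriv (smoothStep (c - ε) c) x) x := by
  have hS : HasDerivAt (smoothStep (c - ε) c) (deriv (smoothStep (c - ε) c) x) x :=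
    (((contDiff_smoothStep _ _).differentiable (by simp)) x).hasDerivAt
  have h1 : HasDerivAt (fun x : ℝ ↦ c - x) (0 - 1) x := (hasDerivAt_const x c).sub (hasDerivAt_id x)
  have h2 : HasDerivAt (fun x : ℝ ↦ x + (c - x) * smoothStep (c - ε) c x)
      (1 + ((0 - 1) * smoothStep (c - ε) c x + (c - x) * deriv (smoothStep (c - ε) c) x)) x :=
    (hasDerivAt_id x).add (h1.mul hS)
  refine h2.congr_deriv ?_
  ring

/-- **Monotonicity below `c`**: for `x ≤ c` the smooth minimum has derivative `≥ 0`. [folklore] -/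
theorem deriv_smoothMinConst_nonneg {c ε x : ℝ} (hε : 0 < ε) (hx : x ≤ c) : 0 ≤ deriv (smoothMinConst c ε) x := by
  rw [(hasDerivAt_smoothMinConst c ε x).deriv]
  have h1 := smoothStep_mem_Icc (c - ε) c x
  have h2 := deriv_smoothStep_nonneg (a := c - ε) (b := c) (by linarith) x
  nlinarith [h1.2, mul_nonneg (sub_nonneg.2 hx) h2]

/-- **Chain rule form**: the smooth minimum of a non-decreasing function bounded by `c` is
non-decreasing. [folklore] -/
theorem deriv_smoothMinConst_comp_nonneg {c ε : ℝ} (hε : 0 < ε) {f : ℝ → ℝ} {t : ℝ} (hf : DifferentiableAt ℝ f t)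
    (hft : f t ≤ c) (hf' : 0 ≤ deriv f t) : 0 ≤ deriv (fun t ↦ smoothMinConst c ε (f t)) t := by
  have hg := hasDerivAt_smoothMinConst c ε (f t)
  have hc : HasDerivAt (fun t ↦ smoothMinConst c ε (f t))
      (((1 - smoothStep (c - ε) c (f t)) + (c - f t) * deriv (smoothStep (c - ε) c) (f t)) * deriv f t) t :=
    hg.comp t hf.hasDerivAt
  rw [hc.deriv]
  have := deriv_smoothMinConst_nonneg hε hft
  rw [hg.deriv] at this
  exact mul_nonneg this hf'

end Literature.Topology.FourManifolds
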